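import Summits.SmoothPoincare4.SmoothPoincare4.Theorems.ConvexBisectionAcyclicBisectionExistsDualHandleModelInj
import HarnessLib

/-!
# Dual handles, XIII: an open domain on which the model of the dual handle embedding is injective
(brick (F-emb-a) of the sub-goal T3b "the complement of the prefix sub-handlebody is the other
piece with the DUAL suffix handles" of stub `stub_steinRealisation` (NF6), line `modp-braid-orbits`
r11, crux `ConvexBisection.AcyclicBisectionExists`, item stmt-SmoothPoincare4-10508; wave 3, lead c5)

Sequel of `…DualHandleModelInj.lean`, where the model `𝓕 = modelF a κ δ` of the dual handle
embedding (`…DualHandleModelMap.lean`) is proved injective on the punctured CLOSED ball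
`{‖z‖ ≤ 1, ‖z_λ‖ < 1} = {s < 1, u ≤ 1}` (`s = ‖z_λ‖²`, `u = ‖z_μ‖²/(1-s)`).  To make `𝓕` an OPEN
smooth embedding around that piece (the next files: invertible differential, inverse function
theorem) one needs injectivity on an OPEN neighbourhood.  Here:

* **the embedding domain `{s < 1, u < 1 + 1/(2(a+1))}`** (an explicit set, no new definition),
  an open neighbourhood of the punctured closed ball (`isOpen_embDom`, `mem_embDom_of_norm_le_one`);
* `FTop_ge` — on it the top-shell profile stays large, `F = 1 + g a (δ s (1-u)) - κ² s u ≥ 5/8`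
  (from `g a t ≥ a t / 2`, `gProfile_ge_linear`), whence `q̃ > 0` (`qTilde_pos_of_FTop_pos`,
  `embDom_subset_modelDom`: `𝓕` is `C^∞` on the embedding domain), the zone separation
  `s q̃ > δ/2` for `s > 1/2` (`sq_qTilde_gt_of_FTop`) and `F - δ s ≥ 1/8 > 0`;
* `qHat_lt_qHat_of_lt` — the strict monotonicity of `qHat p` of `…ModelInj.lean` with its
  hypothesis `p/κ² ≤ s` (i.e. `u ≤ 1`) relaxed to `δ s < F(s)`;
* **`injOn_modelF_embDom`** — `𝓕` is injective on the embedding domain (`0 < a`, `0 < κ ≤ 1/2`,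
  `0 < δ ≤ 1/2`), by the case analysis of `injOn_modelF` run with the relaxed lemmas;
* `helper_injOn_modelF_embDom` (registered).

Everything here is proved; no named facts.

## References
* J. Milnor, *Lectures on the h-cobordism theorem* (1965), §3. [MilnorHCobordism1965]
* A. A. Kosinski, *Differential Manifolds* (1993), VI §6. [Kosinski1993]
-/

noncomputable section

-- the prescribed namespace `Summit.<P>.<Sub>.…` duplicates `SmoothPoincare4` (P = Sub)
set_option linter.dupNamespace false

open scoped Manifold ContDiff Topology

namespace Summit.SmoothPoincare4.SmoothPoincare4.Theorems.AcyclicBisectionExists.ModpBraidOrbits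

open Set Function Metric
open Literature.Topology.FourManifolds Literature.Topology.FourManifolds.HandleAttachingMap

/-! ### §1 Bounds on the profiles with slack in `u` -/

section Bounds

/-- `g a t ≥ a t / 2` below `1` (`0 ≤ a`): `g a t - a t/2 = a t²/(2(1-t)) ≥ 0`. [folklore] -/
theorem gProfile_ge_linear {a t : ℝ} (ha : 0 ≤ a) (ht : t < 1) : a * t / 2 ≤ gProfile a t := by
  unfold gProfile
  rw [div_le_div_iff₀ (by norm_num : (0 : ℝ) < 2) (by linarith : 0 < 2 * (1 - t))]
  nlinarith [mul_nonneg ha (sq_nonneg t)]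

/-- **`F ≥ 5/8` with slack**: for `0 ≤ s < 1`, `0 ≤ u < 1 + 1/(2(a+1))`, `0 < κ ≤ 1/2`,
`0 < δ ≤ 1/2`, `0 < a`, the top-shell profile satisfies `5/8 ≤ F = 1 + g a (δ s (1-u)) - κ² s u`
(`g ≥ -a η/4` on the argument `≥ -η/2`, `κ² s u ≤ (1+η)/4`, `(a+1) η = 1/2`). [folklore] -/
theorem FTop_ge {a κ δ s u : ℝ} (ha : 0 < a) (hκ : 0 < κ) (hκ2 : κ ≤ 1 / 2) (hδ : 0 < δ)
    (hδ2 : δ ≤ 1 / 2) (hs : 0 ≤ s) (hs1 : s < 1) (hu : 0 ≤ u) (hu1 : u < 1 + 1 / (2 * (a + 1))) :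
    5 / 8 ≤ FTop a κ δ s u := by
  unfold FTop
  set η : ℝ := 1 / (2 * (a + 1)) with hη
  have hη0 : 0 < η := by positivity
  have haη : a * η + η = 1 / 2 := by rw [hη]; field_simp
  -- the argument of `g`
  have ht1 : δ * (s * (1 - u)) < 1 := by
    have : s * (1 - u) ≤ s := by nlinarith
    nlinarith
  have ht0 : -(η / 2) ≤ δ * (s * (1 - u)) := by
    have h2 : 0 ≤ s * (1 - u + η) := mul_nonneg hs (by linarith)
    have h4 : δ * s ≤ 1 / 2 := by nlinarith
    have e1 : 0 ≤ δ * (s * (1 - u + η)) := mul_nonneg hδ.le h2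
    have e2 : δ * s * η ≤ 1 / 2 * η := mul_le_mul_of_nonneg_right h4 hη0.le
    have e3 : δ * (s * (1 - u)) = δ * (s * (1 - u + η)) - δ * s * η := by ring
    rw [e3]; linarith
  have hg : -(a * η / 4) ≤ gProfile a (δ * (s * (1 - u))) := by
    have h1 := gProfile_ge_linear ha.le ht1
    have h2 : a * (-(η / 2)) ≤ a * (δ * (s * (1 - u))) := mul_le_mul_of_nonneg_left ht0 ha.le
    linarith
  have hsu : s * u ≤ 1 + η := by nlinarith [mul_le_of_le_one_left hu hs1.le]
  have hκ4 : κ ^ 2 * (s * u) ≤ (1 + η) / 4 := by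
    have : κ ^ 2 ≤ 1 / 4 := by nlinarith [sq_nonneg κ]
    nlinarith [sq_nonneg κ, mul_nonneg hs hu]
  linarith

/-- `q̃ > 0` as soon as `F > 0` (`0 ≤ s`, `0 < δ`). [folklore] -/
theorem qTilde_pos_of_FTop_pos {a κ δ s u : ℝ} (hδ : 0 < δ) (hs : 0 ≤ s)
    (hF : 0 < FTop a κ δ s u) : 0 < qTilde a κ δ s u := by
  unfold qTilde
  have h1 : 0 ≤ shellCutDiv s * FTop a κ δ s u := mul_nonneg (shellCutDiv_nonneg hs) hF.le
  rcases lt_or_ge s (3 / 4) with h | h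
  · have h2 : shellCut s < 1 := Real.smoothTransition.lt_one_of_lt_one (by linarith)
    nlinarith
  · rw [shellCutDiv, shellCut_of_ge h]
    have hs0 : 0 < s := by linarith
    have : 0 < 1 / s * FTop a κ δ s u := by positivity
    linarith

/-- `s · (ω s / s) = ω s` for every `s` (both vanish at `s = 0`). [folklore] -/
theorem mul_shellCutDiv (s : ℝ) : s * shellCutDiv s = shellCut s := by
  rcases eq_or_ne s 0 with h | h
  · rw [h, zero_mul, shellCut_of_le (by norm_num)]
  · rw [shellCutDiv, mul_div_cancel₀ _ h]

/-- `s q̃(s,u) = ω s · F(s,u) + (1 - ω s) δ s` for every `s`. [folklore] -/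
theorem sq_qTilde_eq (a κ δ s u : ℝ) :
    s * qTilde a κ δ s u = shellCut s * FTop a κ δ s u + (1 - shellCut s) * (δ * s) := by
  unfold qTilde
  rw [mul_add, ← mul_assoc, mul_shellCutDiv]; ring

/-- Zone separation with slack: for `s > 1/2` and `F > δ/2` one has `s q̃ > δ/2` (a convex
combination of `F` and `δ s`, both `> δ/2`). [folklore] -/
theorem sq_qTilde_gt_of_FTop {a κ δ s u : ℝ} (hδ : 0 < δ) (hhalf : 1 / 2 < s)
    (hF : δ * (1 / 2) < FTop a κ δ s u) : δ * (1 / 2) < s * qTilde a κ δ s u := by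
  rw [sq_qTilde_eq]
  have hω0 := (shellCut_mem s).1
  have hω1 := (shellCut_mem s).2
  have h2 : δ * (1 / 2) < δ * s := by nlinarith
  nlinarith [mul_nonneg hω0 (sub_nonneg.2 hF.le), mul_nonneg (sub_nonneg.2 hω1) (sub_nonneg.2 h2.le)]

/-- **`qHat p` is strictly increasing, relaxed form.**  For `0 < a`, `0 < δ`, `s < s'`,
`δ (s' - p/κ²) < 1` and `δ s < F(s) := 1 + g a (δ (s - p/κ²)) - p`:
`qHat a κ δ p s < qHat a κ δ p s'` (same proof as `qHat_lt_qHat`, whose hypothesis `p/κ² ≤ s`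
only served to derive `δ s < F(s)`). [folklore] -/
theorem qHat_lt_qHat_of_lt {a κ δ p s s' : ℝ} (ha : 0 < a) (hδ : 0 < δ)
    (hF : δ * s < 1 + gProfile a (δ * (s - p / κ ^ 2)) - p) (h1 : δ * (s' - p / κ ^ 2) < 1)
    (hss : s < s') : qHat a κ δ p s < qHat a κ δ p s' := by
  unfold qHat
  set F : ℝ → ℝ := fun t => 1 + gProfile a (δ * (t - p / κ ^ 2)) - p with hFd
  have hargle : δ * (s - p / κ ^ 2) ≤ δ * (s' - p / κ ^ 2) := by nlinarith
  have hFmono : F s ≤ F s' := by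
    simp only [hFd]
    linarith [gProfile_le_gProfile ha hargle h1]
  have hFs : δ * s < F s := hF
  have hω := shellCut_mono hss.le
  have hω1 := (shellCut_mem s').2
  have key : shellCut s' * F s' + (1 - shellCut s') * (δ * s') -
      (shellCut s * F s + (1 - shellCut s) * (δ * s)) =
      shellCut s' * (F s' - F s) + (1 - shellCut s') * (δ * s' - δ * s) +
        (shellCut s' - shellCut s) * (F s - δ * s) := by
    ring
  have h3 : 0 ≤ (shellCut s' - shellCut s) * (F s - δ * s) := mul_nonneg (by linarith) (by linarith)
  have h1' : 0 ≤ shellCut s' * (F s' - F s) :=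
    mul_nonneg (by linarith [(shellCut_mem s').1]) (by linarith)
  rcases lt_or_eq_of_le hω1 with hlt | heq
  · have h2 : 0 < (1 - shellCut s') * (δ * s' - δ * s) := mul_pos (by linarith) (by nlinarith)
    show shellCut s * F s + (1 - shellCut s) * (δ * s) <
      shellCut s' * F s' + (1 - shellCut s') * (δ * s')
    linarith
  · have hFlt : F s < F s' := by
      simp only [hFd]
      have := gProfile_lt_gProfile ha
        (by nlinarith : δ * (s - p / κ ^ 2) < δ * (s' - p / κ ^ 2)) h1
      linarith
    have h1'' : 0 < shellCut s' * (F s' - F s) := by rw [heq, one_mul]; linarith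
    have h2 : 0 ≤ (1 - shellCut s') * (δ * s' - δ * s) := by rw [heq]; simp
    show shellCut s * F s + (1 - shellCut s) * (δ * s) <
      shellCut s' * F s' + (1 - shellCut s') * (δ * s')
    linarith

end Bounds

/-! ### §2 The embedding domain -/

section Domain

/-- **THE EMBEDDING DOMAIN `{s < 1, u < 1 + 1/(2(a+1))}`** — an open neighbourhood of the
punctured closed ball `{‖z‖ ≤ 1, ‖z_λ‖ < 1} = {s < 1, u ≤ 1}` on which `𝓕 = modelF a κ δ` will be
an open smooth embedding (kept as an explicit set, no definition) — **is open**. [folklore] -/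
theorem isOpen_embDom (a : ℝ) :
    IsOpen {z : EuclideanSpace ℝ (Fin 4) | sOf z < 1 ∧ uOf z < 1 + 1 / (2 * (a + 1))} := by
  have h1 : IsOpen {z : EuclideanSpace ℝ (Fin 4) | sOf z < 1} :=
    isOpen_lt contDiff_sOf.continuous continuous_const
  have h2 : ContinuousOn uOf {z : EuclideanSpace ℝ (Fin 4) | sOf z < 1} :=
    contDiffOn_uOf.continuousOn
  rw [show {z : EuclideanSpace ℝ (Fin 4) | sOf z < 1 ∧ uOf z < 1 + 1 / (2 * (a + 1))} =
      {z | sOf z < 1} ∩ uOf ⁻¹' Iio (1 + 1 / (2 * (a + 1))) from rfl]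
  exact h2.isOpen_inter_preimage h1 isOpen_Iio

/-- **The punctured closed ball `{‖z‖ ≤ 1, s < 1}` lies in the embedding domain** (`0 < a`).
[folklore] -/
theorem mem_embDom_of_norm_le_one {a : ℝ} (ha : 0 < a) {z : EuclideanSpace ℝ (Fin 4)}
    (hz : ‖z‖ ≤ 1) (hs : sOf z < 1) :
    z ∈ {z : EuclideanSpace ℝ (Fin 4) | sOf z < 1 ∧ uOf z < 1 + 1 / (2 * (a + 1))} := by
  refine ⟨hs, ?_⟩
  have h1 := uOf_le_one hz hs
  have h2 : 0 < 1 / (2 * (a + 1)) := by positivity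
  linarith

/-- `F ≥ 5/8` on the embedding domain. [folklore] -/
theorem FTop_ge_of_mem_embDom {a κ δ : ℝ} (ha : 0 < a) (hκ : 0 < κ) (hκ2 : κ ≤ 1 / 2) (hδ : 0 < δ)
    (hδ2 : δ ≤ 1 / 2) {z : EuclideanSpace ℝ (Fin 4)} (hz : z ∈ {z : EuclideanSpace ℝ (Fin 4) | sOf z < 1 ∧ uOf z < 1 + 1 / (2 * (a + 1))}) :
    5 / 8 ≤ FTop a κ δ (sOf z) (uOf z) :=
  FTop_ge ha hκ hκ2 hδ hδ2 (sq_nonneg _) hz.1 (uOf_nonneg hz.1) hz.2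

/-- `q̃ > 0` on the embedding domain. [folklore] -/
theorem qTilde_pos_of_mem_embDom {a κ δ : ℝ} (ha : 0 < a) (hκ : 0 < κ) (hκ2 : κ ≤ 1 / 2)
    (hδ : 0 < δ) (hδ2 : δ ≤ 1 / 2) {z : EuclideanSpace ℝ (Fin 4)} (hz : z ∈ {z : EuclideanSpace ℝ (Fin 4) | sOf z < 1 ∧ uOf z < 1 + 1 / (2 * (a + 1))}) :
    0 < qTilde a κ δ (sOf z) (uOf z) :=
  qTilde_pos_of_FTop_pos hδ (sq_nonneg _)
    (by linarith [FTop_ge_of_mem_embDom (κ := κ) ha hκ hκ2 hδ hδ2 hz])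

/-- The embedding domain lies in the domain of smoothness `modelDom`. [folklore] -/
theorem embDom_subset_modelDom {a κ δ : ℝ} (ha : 0 < a) (hκ : 0 < κ) (hκ2 : κ ≤ 1 / 2)
    (hδ : 0 < δ) (hδ2 : δ ≤ 1 / 2) :
    {z : EuclideanSpace ℝ (Fin 4) | sOf z < 1 ∧ uOf z < 1 + 1 / (2 * (a + 1))} ⊆ modelDom a κ δ := fun _ hz =>
  ⟨hz.1, qTilde_pos_of_mem_embDom ha hκ hκ2 hδ hδ2 hz⟩

/-- **`𝓕` is `C^∞` on the embedding domain.** [folklore] -/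
theorem contDiffOn_modelF_embDom {a κ δ : ℝ} (ha : 0 < a) (hκ : 0 < κ) (hκ2 : κ ≤ 1 / 2)
    (hδ : 0 < δ) (hδ2 : δ ≤ 1 / 2) :
    ContDiffOn ℝ ∞ (modelF a κ δ) {z : EuclideanSpace ℝ (Fin 4) | sOf z < 1 ∧ uOf z < 1 + 1 / (2 * (a + 1))} :=
  (contDiffOn_modelF hκ hδ hδ2).mono (embDom_subset_modelDom ha hκ hκ2 hδ hδ2)

end Domain

/-! ### §3 Injectivity on the embedding domain -/

section Inj

/-- **`𝓕` IS INJECTIVE ON THE EMBEDDING DOMAIN** (`0 < a`, `0 < κ ≤ 1/2`, `0 < δ ≤ 1/2`): the case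
analysis of `injOn_modelF` — equal images have equal squared part-norms `(u 𝓅(s), s q̃)`; the
zones `s ≤ 1/2` (`s q̃ = δ s ≤ δ/2`) and `s > 1/2` (`s q̃ > δ/2`, as `F ≥ 5/8 > δ/2`) cannot mix;
on the top zone `qHat p` is strictly increasing because `δ s ≤ 1/2 < 5/8 ≤ F`.
[cite: MilnorHCobordism1965, §3] -/
theorem injOn_modelF_embDom {a κ δ : ℝ} (ha : 0 < a) (hκ : 0 < κ) (hκ2 : κ ≤ 1 / 2) (hδ : 0 < δ)
    (hδ2 : δ ≤ 1 / 2) :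
    InjOn (modelF a κ δ) {z : EuclideanSpace ℝ (Fin 4) | sOf z < 1 ∧ uOf z < 1 + 1 / (2 * (a + 1))} := by
  intro z hz z' hz' heq
  have hκ2' : 0 < κ ^ 2 := by positivity
  have hu0 := uOf_nonneg hz.1
  have hu0' := uOf_nonneg hz'.1
  have hs0 : 0 ≤ sOf z := sq_nonneg _
  have hs0' : 0 ≤ sOf z' := sq_nonneg _
  have hF := FTop_ge_of_mem_embDom ha hκ hκ2 hδ hδ2 hz
  have hF' := FTop_ge_of_mem_embDom ha hκ hκ2 hδ hδ2 hz'
  have hq := qTilde_pos_of_mem_embDom ha hκ hκ2 hδ hδ2 hz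
  have hq' := qTilde_pos_of_mem_embDom ha hκ hκ2 hδ hδ2 hz'
  have hs1 : sOf z < 1 := hz.1
  have hs1' : sOf z' < 1 := hz'.1
  -- equal part-norms
  have hP : uOf z * pFun κ (sOf z) = uOf z' * pFun κ (sOf z') := by
    rw [← norm_lamPart_modelF_sq hκ hz.1, ← norm_lamPart_modelF_sq hκ hz'.1, heq]
  have hQ : sOf z * qTilde a κ δ (sOf z) (uOf z) = sOf z' * qTilde a κ δ (sOf z') (uOf z') := by
    rw [← norm_muPart_modelF_sq hq, ← norm_muPart_modelF_sq hq', heq]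
  -- `s = s'`
  have hs : sOf z = sOf z' := by
    rcases le_or_gt (sOf z) (1 / 2) with h | h <;> rcases le_or_gt (sOf z') (1 / 2) with h' | h'
    · rw [qTilde_of_le a κ δ h, qTilde_of_le a κ δ h'] at hQ
      nlinarith
    · exfalso
      have h1 := sq_qTilde_gt_of_FTop hδ h' (by linarith : δ * (1 / 2) < FTop a κ δ (sOf z') (uOf z'))
      rw [qTilde_of_le a κ δ h] at hQ
      nlinarith
    · exfalso
      have h1 := sq_qTilde_gt_of_FTop hδ h (by linarith : δ * (1 / 2) < FTop a κ δ (sOf z) (uOf z))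
      rw [qTilde_of_le a κ δ h'] at hQ
      nlinarith
    · -- both on the top zone: `𝓅 = κ² s`, common `p`, strict monotonicity of `qHat p`
      have hz14 : (1 : ℝ) / 4 ≤ sOf z := by linarith
      have hz14' : (1 : ℝ) / 4 ≤ sOf z' := by linarith
      rw [pFun_of_ge κ hz14, pFun_of_ge κ hz14'] at hP
      have hp' : κ ^ 2 * sOf z' * uOf z' = κ ^ 2 * sOf z * uOf z := by linarith
      rw [sq_qTilde_eq_qHat hκ.ne' hz14, sq_qTilde_eq_qHat hκ.ne' hz14', hp'] at hQ
      have hdiv : κ ^ 2 * sOf z * uOf z / κ ^ 2 = sOf z * uOf z := by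
        rw [mul_assoc, mul_div_cancel_left₀ _ hκ2'.ne']
      have hsu' : sOf z * uOf z = sOf z' * uOf z' := by
        have h2 := hp'
        rw [mul_assoc, mul_assoc] at h2
        exact (mul_left_cancel₀ hκ2'.ne' h2).symm
      have hFz : δ * sOf z <
          1 + gProfile a (δ * (sOf z - κ ^ 2 * sOf z * uOf z / κ ^ 2)) - κ ^ 2 * sOf z * uOf z := by
        rw [hdiv]
        have e : δ * (sOf z - sOf z * uOf z) = δ * (sOf z * (1 - uOf z)) := by ring
        rw [e]
        have : δ * sOf z ≤ 1 / 2 := by nlinarith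
        unfold FTop at hF
        linarith
      have hFz' : δ * sOf z' <
          1 + gProfile a (δ * (sOf z' - κ ^ 2 * sOf z * uOf z / κ ^ 2)) - κ ^ 2 * sOf z * uOf z := by
        rw [hdiv, hsu']
        have e : δ * (sOf z' - sOf z' * uOf z') = δ * (sOf z' * (1 - uOf z')) := by ring
        rw [e]
        have : δ * sOf z' ≤ 1 / 2 := by nlinarith
        unfold FTop at hF'
        linarith
      have h1z : δ * (sOf z - κ ^ 2 * sOf z * uOf z / κ ^ 2) < 1 := by
        rw [hdiv]
        nlinarith [mul_nonneg hδ.le (mul_nonneg hs0 hu0)]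
      have h1z' : δ * (sOf z' - κ ^ 2 * sOf z * uOf z / κ ^ 2) < 1 := by
        rw [hdiv, hsu']
        nlinarith [mul_nonneg hδ.le (mul_nonneg hs0' hu0')]
      by_contra hne
      rcases lt_or_gt_of_ne hne with hlt | hlt
      · exact absurd hQ (ne_of_lt (qHat_lt_qHat_of_lt ha hδ hFz h1z' hlt))
      · exact absurd hQ.symm (ne_of_lt (qHat_lt_qHat_of_lt ha hδ hFz' h1z hlt))
  -- `u = u'`
  have huu : uOf z = uOf z' := by
    rw [← hs] at hP
    exact mul_right_cancel₀ (pFun_pos hκ hs0).ne' hP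
  -- the parts
  have hμ : muPart z = muPart z' := by
    have h1 := congrArg lamPart heq
    rw [lamPart_modelF, lamPart_modelF, ← hs] at h1
    exact smul_right_injective _
      (Real.sqrt_pos.2 (div_pos (pFun_pos hκ hs0) (by linarith [hz.1]))).ne' h1
  have hl : lamPart z = lamPart z' := by
    have h1 := congrArg muPart heq
    rw [muPart_modelF, muPart_modelF, ← hs, ← huu] at h1
    exact smul_right_injective _ (Real.sqrt_pos.2 hq).ne' h1
  rw [← lamEmbed_add_muEmbed z, ← lamEmbed_add_muEmbed z', hl, hμ]

/-- **Registered helper `helper_injOn_modelF_embDom` (brick (F-emb-a) of T3b, sub-goal of NF6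
`stub_steinRealisation`, wave 3, lead c5): the model of the dual handle embedding is injective on
the open neighbourhood `{s < 1, u < 1 + 1/(2(a+1))}` of the punctured closed ball.**
[cite: MilnorHCobordism1965, §3] -/
theorem helper_injOn_modelF_embDom : ∀ {a κ δ : ℝ}, 0 < a → 0 < κ → κ ≤ 1 / 2 → 0 < δ → δ ≤ 1 / 2 → Set.InjOn (Summit.SmoothPoincare4.SmoothPoincare4.Theorems.AcyclicBisectionExists.ModpBraidOrbits.modelF a κ δ) {z : EuclideanSpace ℝ (Fin 4) | Summit.SmoothPoincare4.SmoothPoincare4.Theorems.AcyclicBisectionExists.ModpBraidOrbits.sOf z < 1 ∧ Summit.SmoothPoincare4.SmoothPoincare4.Theorems.AcyclicBisectionExists.ModpBraidOrbits.uOf z < 1 + 1 / (2 * (a + 1))} :=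
  fun ha hκ hκ2 hδ hδ2 => injOn_modelF_embDom ha hκ hκ2 hδ hδ2

end Inj

end Summit.SmoothPoincare4.SmoothPoincare4.Theorems.AcyclicBisectionExists.ModpBraidOrbits

end
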